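import Mathlib
import HarnessLib
import Summits.HubbardSuperconductivity.HubbardSuperconductivity.Theorems.KLProgrammeLocalisedCooperDefs
import Literature.MathematicalPhysics.QuantumLattice.HubbardSectorCovariance
import Literature.MathematicalPhysics.QuantumLattice.SectorSymbolMasterBox

/-!
# Route `KLProgramme` — `D₄` on the localised Cooper array, I: sector sites, sector-centre momenta and polar angles under the
# generators of the point group

Cell gate-hubbard-kl, seat p3; first half of the discharge of the hypothesis `hπ` of `KLProgrammeLocalisedCooper.lean` (for each
`γ ∈ D₄` a permutation `σ` of the sector indices with `k⃗_{σω̄} = γ k⃗_ω̄`, `w_{σω̄} = w_ω̄`), completed in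
`KLProgrammeLocalisedCooperEquivariance.lean`.  On the indices `D₄` acts by `ω̄ ↦ N-1-ω̄` (axis reflection: `θ̄ ↦ 2π - θ̄`) and
`ω̄ ↦ ω̄ + N/4 (mod N)` (quarter turn: `θ̄ ↦ θ̄ + π/2`; `N = 2·4ⁿ` sectors, `n ≥ 1`):

* §1 `symmRound_neg` — the symmetric rounding of `KLProgrammeLocalisedCooperDefs` is ODD (the reason `nearestTorusSite` rounds half
  away from zero: with Mathlib's `round`, `½ ↦ 1` but `-½ ↦ 0`, the sector sites would NOT be `D₄`-equivariant at half-integer ties);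
* §2 `nearestTorusSite_rot/_refl` — `p ↦ k⃗(p)` commutes EXACTLY with the quarter turn `(p₁,p₂) ↦ (-p₂,p₁)` / `rotSite` and the
  axis reflection `(p₁,p₂) ↦ (p₁,-p₂)` / `reflSite`;
* §3–§5 `sectorCenter_rev/_quarter`, `klSectorMomentum_rev/_quarter`, **`klSectorSite_rev/_quarter`** — the sector-centre Fermi
  momenta and the sector sites are permuted accordingly (band symmetries `bandFermiRadius_neg/_add_pi_div_two/_add_int_mul_two_pi`,
  `-4 < μ < 0`);
* §6 `torusCentredMomentum_rotSite/_reflSite`, **`momentumAngle_rotSite/_reflSite`** — as `Real.Angle`, `θ(rot k⃗) = θ(k⃗) + π/2` and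
  `θ(refl k⃗) = -θ(k⃗)` for `k⃗ ≠ 0` off the zone boundary `2k₂ = L` (there the centred representative `(-π, π]²` is not
  equivariant; `ZMod.valMinAbs_neg_of_ne_half`, `Complex.arg_mul_coe_angle`, `Complex.arg_conj_coe_angle`);
* §7 `sectorWeightCirc_quarter` (`ζ̃_{ω+2^{m-1}}(θ + π/2) = ζ̃_ω(θ)`), `sectorWeightCirc_neg_angle` (`ζ̃_ω(-θ) = ζ̃_{-1-ω}(θ)`, the
  profile is even: `sectorUnitWeight_neg`), `sectorWeightCirc_add_nat_mul_sectorCount`, and their momentum forms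
  `sectorWeightCirc_momentumAngle_rotSite/_reflSite`.

Everything is proved; no definitions.  References: HOME/p3/C2-LEAN-GUIDE.md §2; HOME/p1/ENGINE-PRED.md §0 Q-E2, §7; BGM 2006
§2.5 (2.45) (sectors), §2.1 (lattice symmetries of the band).
-/

noncomputable section

namespace Summit.HubbardSuperconductivity.HubbardSuperconductivity.Theorems.KLProgrammeLegKernels

set_option linter.dupNamespace false -- summit = problem name (single-conjunct summit), D-0017

open Real Literature.MathematicalPhysics.QuantumLattice Literature.Probability.LatticeModels
open Summit.HubbardSuperconductivity.HubbardSuperconductivity.Theorems.CooperVertexBlocks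

/-! ### §1 Symmetric rounding is odd -/

/-- On `[0, ∞)` the symmetric rounding is Mathlib's `round`. -/
theorem symmRound_of_nonneg {x : ℝ} (hx : 0 ≤ x) : symmRound x = round x := if_pos hx

/-- **`symmRound` is odd**: `symmRound (-x) = -symmRound x` (ties included). -/
theorem symmRound_neg (x : ℝ) : symmRound (-x) = -symmRound x := by
  unfold symmRound
  rcases lt_trichotomy x 0 with hx | rfl | hx
  · rw [if_pos (by linarith), if_neg (not_le.2 hx), neg_neg]
  · simp
  · rw [if_neg (by linarith), if_pos hx.le, neg_neg]

/-- The symmetric rounding is within `1/2`: `|x - symmRound x| ≤ 1/2`. -/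
theorem abs_sub_symmRound_le (x : ℝ) : |x - symmRound x| ≤ 1 / 2 := by
  unfold symmRound
  split_ifs with hx
  · exact abs_sub_round x
  · have h := abs_sub_round (-x)
    rw [Int.cast_neg, show x - -((round (-x) : ℤ) : ℝ) = -((-x) - round (-x)) by ring, abs_neg]
    exact h

/-! ### §2 The nearest lattice momentum is `D₄`-equivariant -/

section Sites

variable (L : ℕ)

/-- **Quarter turn**: `nearestTorusSite L (-p₂, p₁) = rotSite (nearestTorusSite L p)`. -/
theorem nearestTorusSite_rot (p : ℝ × ℝ) : nearestTorusSite L (-p.2, p.1) = rotSite (nearestTorusSite L p) := by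
  ext i
  fin_cases i
  · simp [nearestTorusSite, rotSite, mul_neg, neg_div, symmRound_neg]
  · simp [nearestTorusSite, rotSite]

/-- **Axis reflection**: `nearestTorusSite L (p₁, -p₂) = reflSite (nearestTorusSite L p)`. -/
theorem nearestTorusSite_refl (p : ℝ × ℝ) : nearestTorusSite L (p.1, -p.2) = reflSite (nearestTorusSite L p) := by
  ext i
  fin_cases i
  · simp [nearestTorusSite, reflSite]
  · simp [nearestTorusSite, reflSite, mul_neg, neg_div, symmRound_neg]

end Sites

/-! ### §3 Sector centres under the index maps `ω ↦ N-1-ω` and `ω ↦ ω + N/4` -/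

/-- `N · w_m = 2π` with `N = sectorCount m` cast through `ℕ`. -/
theorem sectorCount_mul_sectorWidth' (m : ℕ) : ((sectorCount m : ℕ) : ℝ) * sectorWidth m = 2 * π :=
  sectorCount_mul_sectorWidth m

/-- **Reflected index**: `θ̄_{N-1-ω} = 2π - θ̄_ω`. -/
theorem sectorCenter_rev (m : ℕ) (ω : Fin (sectorCount m)) :
    sectorCenter m (Fin.rev ω : ℕ) = 2 * π - sectorCenter m ω := by
  rw [sectorCenter, sectorCenter, Fin.val_rev, ← sectorCount_mul_sectorWidth m]
  have h : (ω : ℕ) + 1 ≤ sectorCount m := ω.2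
  rw [Nat.cast_sub h]
  push_cast
  ring

/-- **Quarter-shifted index**: for `m ≥ 1` and `ω' ≡ ω + 2^{m-1} (mod N)` (as the reduced residue),
`θ̄_{ω'} = θ̄_ω + π/2 - q · 2π` with `q = (ω + 2^{m-1}) / N ∈ ℕ`. -/
theorem sectorCenter_quarter {m : ℕ} (hm : 1 ≤ m) (ω : ℕ) :
    sectorCenter m ((ω + 2 ^ (m - 1)) % sectorCount m) =
      sectorCenter m ω + π / 2 - (((ω + 2 ^ (m - 1)) / sectorCount m : ℕ) : ℝ) * (2 * π) := by
  have hN := sectorCount_mul_sectorWidth m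
  have hdm := Nat.div_add_mod (ω + 2 ^ (m - 1)) (sectorCount m)
  have hq : (((ω + 2 ^ (m - 1)) % sectorCount m : ℕ) : ℝ) =
      (ω : ℝ) + (2 : ℝ) ^ (m - 1) - (sectorCount m : ℝ) * (((ω + 2 ^ (m - 1)) / sectorCount m : ℕ) : ℝ) := by
    have h := congrArg (fun t : ℕ => (t : ℝ)) hdm
    simp only [Nat.cast_add, Nat.cast_mul, Nat.cast_pow, Nat.cast_ofNat] at h
    linarith
  have hc : (2 : ℝ) ^ (m - 1) * sectorWidth m = π / 2 := by
    rw [sectorWidth]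
    obtain ⟨j, rfl⟩ := Nat.exists_eq_add_of_le hm
    rw [Nat.add_sub_cancel_left, pow_add, pow_one]
    field_simp
  rw [sectorCenter, sectorCenter, hq]
  linear_combination (-(((ω + 2 ^ (m - 1)) / sectorCount m : ℕ) : ℝ)) * hN + hc

/-! ### §4 The sector-centre momenta are `D₄`-equivariant -/

section Momenta

variable {μ : ℝ} (hμ₁ : -4 < μ) (hμ₂ : μ < 0)
include hμ₁ hμ₂

/-- **Reflection**: `p̄(N-1-ω̄) = (p̄₁(ω̄), -p̄₂(ω̄))`. -/
theorem klSectorMomentum_rev (n : ℕ) (ω : Fin (sectorCount (2 * n))) :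
    klSectorMomentum μ n (Fin.rev ω) = ((klSectorMomentum μ n ω).1, -(klSectorMomentum μ n ω).2) := by
  simp only [klSectorMomentum, bandX, bandY]
  rw [sectorCenter_rev]
  set θ := sectorCenter (2 * n) ω
  have h1 : 2 * π - θ = -θ + (1 : ℤ) * (2 * π) := by push_cast; ring
  rw [h1, bandFermiRadius_add_int_mul_two_pi hμ₁ hμ₂, bandFermiRadius_neg hμ₁ hμ₂,
    Real.cos_add_int_mul_two_pi, Real.sin_add_int_mul_two_pi, Real.cos_neg, Real.sin_neg]
  simp

/-- **Quarter turn**: if `ω' ≡ ω + 2^{2n-1} (mod N)` (reduced residue) and `n ≥ 1` then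
`p̄(ω̄') = (-p̄₂(ω̄), p̄₁(ω̄))`. -/
theorem klSectorMomentum_quarter {n : ℕ} (hn : 1 ≤ n) {ω ω' : Fin (sectorCount (2 * n))}
    (h : (ω' : ℕ) = ((ω : ℕ) + 2 ^ (2 * n - 1)) % sectorCount (2 * n)) :
    klSectorMomentum μ n ω' = (-(klSectorMomentum μ n ω).2, (klSectorMomentum μ n ω).1) := by
  simp only [klSectorMomentum, bandX, bandY]
  rw [h, sectorCenter_quarter (by omega)]
  set θ := sectorCenter (2 * n) ω
  set q : ℕ := ((ω : ℕ) + 2 ^ (2 * n - 1)) / sectorCount (2 * n)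
  have h1 : θ + π / 2 - (q : ℝ) * (2 * π) = θ + π / 2 + ((-(q : ℤ)) : ℤ) * (2 * π) := by push_cast; ring
  rw [h1, bandFermiRadius_add_int_mul_two_pi hμ₁ hμ₂, bandFermiRadius_add_pi_div_two hμ₁ hμ₂,
    Real.cos_add_int_mul_two_pi, Real.sin_add_int_mul_two_pi, Real.cos_add_pi_div_two, Real.sin_add_pi_div_two]
  simp

end Momenta


/-! ### §5 The sector sites are `D₄`-equivariant (generators) -/

section SectorSites

variable (L : ℕ) {μ : ℝ} (hμ₁ : -4 < μ) (hμ₂ : μ < 0)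
include hμ₁ hμ₂

/-- **Reflection of sector sites**: `k⃗_{N-1-ω̄} = refl k⃗_ω̄`. -/
theorem klSectorSite_rev (n : ℕ) (ω : Fin (sectorCount (2 * n))) :
    klSectorSite L μ n (Fin.rev ω) = reflSite (klSectorSite L μ n ω) := by
  rw [klSectorSite, klSectorSite, klSectorMomentum_rev hμ₁ hμ₂]
  exact nearestTorusSite_refl L _

/-- **Quarter turn of sector sites**: `k⃗_{ω̄ + N/4} = rot k⃗_ω̄` (`n ≥ 1`). -/
theorem klSectorSite_quarter {n : ℕ} (hn : 1 ≤ n) {ω ω' : Fin (sectorCount (2 * n))}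
    (h : (ω' : ℕ) = ((ω : ℕ) + 2 ^ (2 * n - 1)) % sectorCount (2 * n)) :
    klSectorSite L μ n ω' = rotSite (klSectorSite L μ n ω) := by
  rw [klSectorSite, klSectorSite, klSectorMomentum_quarter hμ₁ hμ₂ hn h]
  exact nearestTorusSite_rot L _

end SectorSites

/-! ### §6 The polar angle of a torus momentum under the generators (off the zone boundary) -/

section Angles

variable (L : ℕ) [NeZero L]

/-- Centred momentum of the quarter turn: `p(rot k⃗) = (-p₂, p₁)` when `p₂ ≠ π` (`2 k₂ ≠ L`). -/
theorem torusCentredMomentum_rotSite {k : TorusSite 2 L} (hk : 2 * (k 1).val ≠ L) :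
    torusCentredMomentum L (rotSite k) = ![-torusCentredMomentum L k 1, torusCentredMomentum L k 0] := by
  rw [torusCentredMomentum_eq_valMinAbs, torusCentredMomentum_eq_valMinAbs]
  ext j
  fin_cases j
  · simp [rotSite, ZMod.valMinAbs_neg_of_ne_half hk]
  · simp [rotSite]

/-- Centred momentum of the axis reflection: `p(refl k⃗) = (p₁, -p₂)` when `p₂ ≠ π`. -/
theorem torusCentredMomentum_reflSite {k : TorusSite 2 L} (hk : 2 * (k 1).val ≠ L) :
    torusCentredMomentum L (reflSite k) = ![torusCentredMomentum L k 0, -torusCentredMomentum L k 1] := by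
  rw [torusCentredMomentum_eq_valMinAbs, torusCentredMomentum_eq_valMinAbs]
  ext j
  fin_cases j
  · simp [reflSite]
  · simp [reflSite, ZMod.valMinAbs_neg_of_ne_half hk]

/-- A non-zero torus momentum has non-zero centred representative. -/
theorem torusCentredMomentum_ne_zero {k : TorusSite 2 L} (hk : k ≠ 0) : torusCentredMomentum L k ≠ 0 := by
  intro h
  apply hk
  funext j
  have hj := congrFun h j
  rw [torusCentredMomentum_eq_valMinAbs] at hj
  have hL : (0 : ℝ) < L := Nat.cast_pos.2 (Nat.pos_of_ne_zero (NeZero.ne L))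
  have h2 : (((k j).valMinAbs : ℤ) : ℝ) = 0 := by
    rcases mul_eq_zero.1 hj with h' | h'
    · exfalso
      have : (0 : ℝ) < 2 * π / L := div_pos two_pi_pos hL
      linarith
    · exact h'
  have h3 : (k j).valMinAbs = 0 := by exact_mod_cast h2
  exact (ZMod.valMinAbs_eq_zero _).1 h3

/-- **Quarter turn rotates the polar angle by `π/2` (mod `2π`)**, off the origin and the zone boundary. -/
theorem momentumAngle_rotSite {k : TorusSite 2 L} (hk0 : k ≠ 0) (hk : 2 * (k 1).val ≠ L) :
    ((momentumAngle L (rotSite k) : ℝ) : Real.Angle) =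
      (momentumAngle L k : Real.Angle) + ((π / 2 : ℝ) : Real.Angle) := by
  have hz : momToComplex (torusCentredMomentum L k) ≠ 0 := fun h =>
    torusCentredMomentum_ne_zero L hk0 ((momToComplex_eq_zero_iff _).1 h)
  have hI : momToComplex (torusCentredMomentum L (rotSite k)) = Complex.I * momToComplex (torusCentredMomentum L k) := by
    rw [torusCentredMomentum_rotSite L hk]
    apply Complex.ext <;> simp
  rw [momentumAngle, momentumAngle, polarAngle, polarAngle, hI, Complex.arg_mul_coe_angle Complex.I_ne_zero hz,
    Complex.arg_I, add_comm]

/-- **The axis reflection negates the polar angle (mod `2π`)**, off the zone boundary. -/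
theorem momentumAngle_reflSite {k : TorusSite 2 L} (hk : 2 * (k 1).val ≠ L) :
    ((momentumAngle L (reflSite k) : ℝ) : Real.Angle) = -(momentumAngle L k : Real.Angle) := by
  have hc : momToComplex (torusCentredMomentum L (reflSite k)) =
      (starRingEnd ℂ) (momToComplex (torusCentredMomentum L k)) := by
    rw [torusCentredMomentum_reflSite L hk]
    apply Complex.ext <;> simp
  rw [momentumAngle, momentumAngle, polarAngle, polarAngle, hc, Complex.arg_conj_coe_angle]

end Angles

/-! ### §7 The sector weights on the circle under `θ ↦ θ + π/2`, `θ ↦ -θ` and index shifts -/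

/-- **Quarter turn of the angular partition**: `ζ̃_{m,ω+2^{m-1}}(θ + π/2) = ζ̃_{m,ω}(θ)` (`2^{m-1} w_m = π/2`, `m ≥ 1`). -/
theorem sectorWeightCirc_quarter {m : ℕ} (hm : 1 ≤ m) (ω : ℤ) (θ : ℝ) :
    sectorWeightCirc m (ω + 2 ^ (m - 1)) (θ + π / 2) = sectorWeightCirc m ω θ := by
  unfold sectorWeightCirc
  refine tsum_congr fun k => ?_
  simp only [sectorWeight]
  congr 1
  have hw : sectorWidth m ≠ 0 := (sectorWidth_pos m).ne'
  have hπw : π / 2 / sectorWidth m = 2 ^ (m - 1) := by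
    rw [sectorWidth]
    obtain ⟨j, rfl⟩ := Nat.exists_eq_add_of_le hm
    rw [Nat.add_sub_cancel_left, pow_add, pow_one]
    field_simp
  push_cast
  rw [add_div, hπw]
  ring

/-- **Reflection of the angular partition**: `ζ_{m,j}(-θ) = ζ_{m,-1-j}(θ)` (the profile is even). -/
theorem sectorWeight_neg_angle (m : ℕ) (j : ℤ) (θ : ℝ) : sectorWeight m j (-θ) = sectorWeight m (-1 - j) θ := by
  simp only [sectorWeight]
  rw [← sectorUnitWeight_neg]
  congr 1
  push_cast
  ring

/-- `ζ̃_{m,ω}(-θ) = ζ̃_{m,-1-ω}(θ)`. -/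
theorem sectorWeightCirc_neg_angle (m : ℕ) (ω : ℤ) (θ : ℝ) :
    sectorWeightCirc m ω (-θ) = sectorWeightCirc m (-1 - ω) θ := by
  unfold sectorWeightCirc
  rw [← (Equiv.neg ℤ).tsum_eq (fun k : ℤ => sectorWeight m ((-1 - ω) + k * sectorCount m) θ)]
  refine tsum_congr fun k => ?_
  rw [sectorWeight_neg_angle, Equiv.neg_apply]
  congr 1
  ring

/-- `N`-periodicity in the index, natural multiples: `ζ̃_{m,ω+qN} = ζ̃_{m,ω}`. -/
theorem sectorWeightCirc_add_nat_mul_sectorCount (m : ℕ) (ω : ℤ) (q : ℕ) (θ : ℝ) :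
    sectorWeightCirc m (ω + q * sectorCount m) θ = sectorWeightCirc m ω θ := by
  induction q with
  | zero => simp
  | succ q ih =>
    rw [show ω + ((q + 1 : ℕ) : ℤ) * (sectorCount m : ℤ) = (ω + q * sectorCount m) + sectorCount m by push_cast; ring,
      sectorWeightCirc_add_sectorCount, ih]

section AngleWeights

variable (L : ℕ) [NeZero L]

/-- **Sector weight of the quarter-turned momentum**: `ζ̃_{m,ω+2^{m-1}}(θ(rot k⃗)) = ζ̃_{m,ω}(θ(k⃗))` for `k⃗ ≠ 0` off the zone boundary. -/
theorem sectorWeightCirc_momentumAngle_rotSite {m : ℕ} (hm : 1 ≤ m) (ω : ℤ) {k : TorusSite 2 L} (hk0 : k ≠ 0)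
    (hk : 2 * (k 1).val ≠ L) :
    sectorWeightCirc m (ω + 2 ^ (m - 1)) (momentumAngle L (rotSite k)) = sectorWeightCirc m ω (momentumAngle L k) := by
  have h := momentumAngle_rotSite L hk0 hk
  rw [← Real.Angle.coe_add, Real.Angle.angle_eq_iff_two_pi_dvd_sub] at h
  obtain ⟨z, hz⟩ := h
  rw [show momentumAngle L (rotSite k) = momentumAngle L k + π / 2 + z * (2 * π) by linarith,
    (periodic_sectorWeightCirc m _).int_mul z, sectorWeightCirc_quarter hm]

/-- **Sector weight of the reflected momentum**: `ζ̃_{m,-1-ω}(θ(refl k⃗)) = ζ̃_{m,ω}(θ(k⃗))` off the zone boundary. -/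
theorem sectorWeightCirc_momentumAngle_reflSite (m : ℕ) (ω : ℤ) {k : TorusSite 2 L} (hk : 2 * (k 1).val ≠ L) :
    sectorWeightCirc m (-1 - ω) (momentumAngle L (reflSite k)) = sectorWeightCirc m ω (momentumAngle L k) := by
  have h := momentumAngle_reflSite L hk
  rw [← Real.Angle.coe_neg, Real.Angle.angle_eq_iff_two_pi_dvd_sub] at h
  obtain ⟨z, hz⟩ := h
  rw [show momentumAngle L (reflSite k) = -momentumAngle L k + z * (2 * π) by linarith,
    (periodic_sectorWeightCirc m _).int_mul z, sectorWeightCirc_neg_angle]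
  congr 1
  ring

end AngleWeights

end Summit.HubbardSuperconductivity.HubbardSuperconductivity.Theorems.KLProgrammeLegKernels

end
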